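import Literature.NumberTheory.LFunctions.RiemannSiegelStirlingThirdOrder
import Literature.NumberTheory.LFunctions.RiemannSiegelThetaBounds
import Literature.NumberTheory.LFunctions.SchoenfeldZerosLow
import Literature.NumberTheory.LFunctions.TuringMethodProofs
import HarnessLib

/-!
# RH-FREE — `∫ S(t) dt` between `2π` and `168π`: reduction of Brent–Platt–Trudgian's standing condition (2.9) on the initial range to a finite computation over the certified zeros, and the range `T > 168π` from Trudgian's theorem («nothing here bears on the truth of RH»)

Topic `Literature/NumberTheory/LFunctions` (RH literature-typing tranche 1, L4 "explicit zero
statistics", gen 8). Label: **RH-FREE**. THEOREMS only — NO definition, NO new named fact (D-0026).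
Nothing here bears on the truth of RH.

Brent–Platt–Trudgian, Math. Comp. 90 (2021), §2 eq. (2.9) and the sentence after it: "From
[Trudgian 2011], `|S₁(T) − c₀| ≤ A₀ + A₁ log T` for all `T ≥ 168π` … However, a small computation
shows that (2.9) also holds for `T ∈ [2π, 168π]`." — the named fact
`Literature.NumberTheory.LFunctions.BrentPlattTrudgian2021_eq29` (`ZetaZeroSumsLehmanExplicit.lean`), with
`S₁(T) − c₀ = ∫_{168π}^T S(t) dt`, `S = zetaArgS = N − θ/π − 1`. This file is the ANALYTIC half
of its discharge (the arithmetic half is `ZetaArgSIntegralLowHeightNumerics.lean`):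

* `integral_zetaArgS_from_168pi_le_of_lt` — **the range `T > 168π`**: Trudgian 2011, Thm 2.2 is the
  tree's THEOREM `abs_integral_zetaArgS_le_trudgian_holds` for lower limits `t₁ > 168π`; the lower
  limit `168π` itself follows by continuity of `t₁ ↦ ∫_{168π}^{t₁} S` (`S` is locally integrable).
* `zetaZeroCount_eq_sum_ite_lowOrdinate` — for `0 ≤ t ≤ 2516`, `N(t) = Σ_{j<2000} [γ_j ≤ t]` with
  the tree's certified ordinates `γ_j = lowOrdinate j` (all zeros below `2516` simple, on the line,
  `N(2516) = 2000`: `SchoenfeldZerosLow.lean`); hence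
  `integral_zetaZeroCount_eq_sum` — **`∫_b^c N(t) dt = Σ_{j<2000} max(0, c − max(γ_j, b))`** for
  `0 ≤ b ≤ c ≤ 2516`.
* (private) `integral_thetaMain_eq` — the closed-form integral of the three-term Stirling main part
  `θ₃(t) = (t/2)log(t/2π) − t/2 − π/8 + 1/(48t) + 7/(5760t³)`:
  `∫_b^c θ₃ = Θ₃(c) − Θ₃(b)`, `Θ₃(x) = (x²/4)log(x/2π) − 3x²/8 − πx/8 + (log x)/48 − 7/(11520x²)`;
  `abs_riemannSiegelTheta_sub_main_le_const` — `|θ(t) − θ₃(t)| ≤ 1.2·10⁻⁵` for `t ≥ 2π` (the tree's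
  third-order Stirling bound `abs_riemannSiegelTheta_sub_stirling_three_le`).
* (private) `abs_riemannSiegelTheta_sub_le_mul_sub` — `|θ(t) − θ(s)| ≤ 2.75 (t − s)` for `2π ≤ s ≤ t ≤ 168π`
  (`|θ'(u) − ½ log(u/2π)| ≤ 2/u`, `log(u/2π) ≤ log 128 = 7 log 2`).
* `pi_mul_integral_zetaArgS_eq_count_sub_theta`, `abs_integral_zetaArgS_le_of_cell` — on a cell `[a, b] ⊆ [2π, 168π]`
  of width `≤ 1/4`: for `T ∈ [a, b]`, `π∫_T^b S` lies between `−(1/4)·max(0, θ⁺ + π − π N⁻)` and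
  `(1/4)·max(0, π N⁺ − θ⁻ − π)` whenever `N⁻ ≤ N(a)`, `N(b) ≤ N⁺`, `θ⁻ ≤ θ ≤ θ⁺` on `[a, b]`
  (`S = N − θ/π − 1`, `N` monotone), and
  `pi_mul_integral_zetaArgS_eq_sum_sub` — **`π ∫_b^{168π} S = π Σ_j max(0, 168π − max(γ_j, b))
  − (Θ₃(168π) − Θ₃(b)) − ∫_b^{168π}(θ − θ₃) − π(168π − b)`** with `|∫_b^{168π} (θ − θ₃)| ≤ 0.0063`;
  `abs_pi_mul_integral_zetaArgS_sub_closedForm_le_sharp` (gen 8, second pass) — the same closed form with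
  the `−7/(11520x²)` term kept and the sharp error `≤ 1.6·10⁻⁵` (for the computation of `S₁(168π)`).

## References

* R. P. Brent, D. J. Platt, T. S. Trudgian, *The mean square of the error term in the prime number
  theorem*, Math. Comp. 90 (2021) 2923–2935 (arXiv:2008.06140), §2 eq. (2.9). [BrentPlattTrudgian2021]
* T. S. Trudgian, *Improvements to Turing's method*, Math. Comp. 80 (2011) 2259–2279, Thm 2.2. [Trudgian2011]
* A. M. Odlyzko, H. J. J. te Riele, J. reine angew. Math. 357 (1985), §4.2 (the first `2000` zeros;
  the tree's certificate). [OdlyzkoTeRiele1985]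
-/

noncomputable section

open Complex Real Set Filter MeasureTheory intervalIntegral
open scoped Topology

namespace Literature.NumberTheory.LFunctions

open SchoenfeldBound ZetaNumerics.Mertens

/-! ### The range `T > 168π`: Trudgian's theorem down to the lower limit `168π` -/

/-- **(2.9) for `T > 168π` with NO hypothesis**: `|∫_{168π}^T S(t) dt| ≤ 2.067 + 0.059 log T`.
Trudgian 2011, Thm 2.2 (`abs_integral_zetaArgS_le_trudgian_holds`) gives this for every lower limit
`t₁ ∈ (168π, T)`; let `t₁ → 168π⁺` (the primitive of the locally integrable `S` is continuous).
[cite: Trudgian2011, Thm. 2.2] [cite: BrentPlattTrudgian2021, §2 eq. (2.9)] -/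
theorem abs_integral_zetaArgS_from_168pi_le_of_lt {T : ℝ} (hT : 168 * π < T) :
    |∫ t in (168 * π)..T, zetaArgS t| ≤ 2.067 + 0.059 * Real.log T := by
  set U : ℝ := 168 * π with hU
  -- the primitive `F(s) = ∫_U^s S` is continuous, and `∫_U^T S = F(s) + ∫_s^T S`
  have hcont : Continuous fun s ↦ ∫ t in U..s, zetaArgS t :=
    intervalIntegral.continuous_primitive (fun a b ↦ intervalIntegrable_zetaArgS a b) U
  have hlim : Tendsto (fun s ↦ ∫ t in U..s, zetaArgS t) (𝓝[>] U) (𝓝 0) := by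
    have h := (hcont.tendsto U).mono_left (nhdsWithin_le_nhds (s := Ioi U))
    rwa [intervalIntegral.integral_same] at h
  have hbound : ∀ᶠ s in 𝓝[>] U, |∫ t in U..T, zetaArgS t| ≤
      (2.067 + 0.059 * Real.log T) + |∫ t in U..s, zetaArgS t| := by
    filter_upwards [Ioo_mem_nhdsGT hT] with s hs
    have hsplit : ∫ t in U..T, zetaArgS t = (∫ t in U..s, zetaArgS t) + ∫ t in s..T, zetaArgS t :=
      (intervalIntegral.integral_add_adjacent_intervals (intervalIntegrable_zetaArgS _ _)
        (intervalIntegrable_zetaArgS _ _)).symm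
    have hTr := abs_integral_zetaArgS_le_trudgian_holds hs.1 hs.2
    rw [hsplit]
    have := abs_add_le (∫ t in U..s, zetaArgS t) (∫ t in s..T, zetaArgS t)
    linarith
  have hlim' : Tendsto (fun s ↦ (2.067 + 0.059 * Real.log T) + |∫ t in U..s, zetaArgS t|)
      (𝓝[>] U) (𝓝 ((2.067 + 0.059 * Real.log T) + |(0 : ℝ)|)) :=
    tendsto_const_nhds.add (continuous_abs.continuousAt.tendsto.comp hlim)
  rw [abs_zero, add_zero] at hlim'
  exact le_of_tendsto_of_tendsto tendsto_const_nhds hlim' hbound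

/-- **(2.9) for `T ≥ 168π` with NO hypothesis** (at `T = 168π` the integral vanishes).
[cite: Trudgian2011, Thm. 2.2] [cite: BrentPlattTrudgian2021, §2 eq. (2.9)] -/
theorem abs_integral_zetaArgS_from_168pi_le_of_le {T : ℝ} (hT : 168 * π ≤ T) :
    |∫ t in (168 * π)..T, zetaArgS t| ≤ 2.067 + 0.059 * Real.log T := by
  rcases hT.eq_or_lt with h | h
  · rw [← h, intervalIntegral.integral_same, abs_zero]
    have hπ : 3 < π := Real.pi_gt_three
    have : 0 ≤ Real.log (168 * π) := Real.log_nonneg (by linarith)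
    positivity
  · exact abs_integral_zetaArgS_from_168pi_le_of_lt h

/-! ### `N(t)` below `2516` as a sum of indicators of the certified ordinates -/

/-- For `0 ≤ t ≤ 2516`: `zerosBetween 0 t = {½ + iγ_j : j < 2000, γ_j ≤ t}`.
[cite: OdlyzkoTeRiele1985, §4.2 p. 151] -/
theorem zerosBetween_zero_eq_image_filter {t : ℝ} (ht : t ≤ heightT0) :
    zerosBetween 0 t = ((Finset.range 2000).filter fun j ↦ lowOrdinate j ≤ t).image
      fun j ↦ (1 / 2 + lowOrdinate j * I : ℂ) := by
  classical
  ext ρ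
  rw [mem_zerosBetween le_rfl, Finset.mem_image]
  constructor
  · rintro ⟨hz, h0, h1, him, hT⟩
    obtain ⟨j, hj, rfl⟩ := zero_eq_of_im_le_heightT0 hz h0 h1 him (hT.trans ht)
    refine ⟨j, Finset.mem_filter.2 ⟨Finset.mem_range.2 hj, ?_⟩, rfl⟩
    simpa using hT
  · rintro ⟨j, hj, rfl⟩
    rw [Finset.mem_filter, Finset.mem_range] at hj
    obtain ⟨hp, -⟩ := lowOrdinate_pos_lt hj.1
    exact ⟨(lowOrdinate_spec hj.1).2, by simp, by norm_num, by simpa using hp, by simpa using hj.2⟩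

/-- **`N(t) = Σ_{j<2000} [γ_j ≤ t]`** for `0 ≤ t ≤ 2516` (all zeros below `2516` are the simple zeros
`½ + iγ_j`, `j < 2000`). [cite: OdlyzkoTeRiele1985, §4.2 p. 151] -/
theorem zetaZeroCount_eq_sum_ite_lowOrdinate {t : ℝ} (h0 : 0 ≤ t) (ht : t ≤ heightT0) :
    (zetaZeroCount t : ℝ) = ∑ j ∈ Finset.range 2000, if lowOrdinate j ≤ t then (1 : ℝ) else 0 := by
  classical
  have hsub := zetaZeroCount_sub_eq_sum h0
  rw [zetaZeroCount_eq_zero_of_nonpos le_rfl, Nat.cast_zero, sub_zero,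
    zerosBetween_zero_eq_image_filter ht] at hsub
  have heinj : Set.InjOn (fun j ↦ (1 / 2 + lowOrdinate j * I : ℂ))
      ((Finset.range 2000).filter fun j ↦ lowOrdinate j ≤ t : Finset ℕ) := by
    intro j hj j' hj' h
    have hj2 : j ∈ (Finset.range 2000 : Set ℕ) := by
      simp only [Finset.coe_filter, Set.mem_setOf_eq] at hj; simpa using hj.1
    have hj2' : j' ∈ (Finset.range 2000 : Set ℕ) := by
      simp only [Finset.coe_filter, Set.mem_setOf_eq] at hj'; simpa using hj'.1
    exact lowOrdinate_injOn hj2 hj2' (by have := congrArg Complex.im h; simpa using this)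
  rw [Finset.sum_image heinj] at hsub
  rw [hsub, Finset.sum_filter]
  refine Finset.sum_congr rfl fun j hj ↦ ?_
  rw [Finset.mem_range] at hj
  split_ifs with h
  · rw [riemannZetaZeroOrder_lowOrdinate hj]; simp
  · rfl

/-! ### `∫ N` over an interval below `2516` -/

/-- `∫_b^c [γ ≤ t] dt = max(0, c − max(γ, b))` for `b ≤ c`. [folklore] -/
private theorem integral_ite_le_eq_max {b c γ : ℝ} (hbc : b ≤ c) :
    ∫ t in b..c, (if γ ≤ t then (1 : ℝ) else 0) = max 0 (c - max γ b) := by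
  rcases le_or_gt γ b with hγb | hγb
  · -- `γ ≤ b`: the integrand is `1` on `(b, c]`
    rw [max_eq_right hγb, max_eq_right (by linarith), integral_of_le hbc,
      setIntegral_congr_fun measurableSet_Ioc (g := fun _ ↦ (1 : ℝ))
        (fun t ht ↦ by simp [hγb.trans ht.1.le])]
    simp [hbc]
  rcases le_or_gt γ c with hγc | hγc
  · -- `b < γ ≤ c`
    have h := integral_indicator_mul_eq hγb hγc (g := fun _ ↦ (1 : ℝ)) continuousOn_const
    simp only [mul_one, intervalIntegral.integral_const, smul_eq_mul] at h
    rw [h, max_eq_left hγb.le, max_eq_right (by linarith)]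
  · -- `γ > c`: the integrand vanishes on `[b, c]`
    rw [max_eq_left hγb.le, max_eq_left (by linarith), integral_of_le hbc,
      setIntegral_congr_fun measurableSet_Ioc (g := fun _ ↦ (0 : ℝ))
        (fun t ht ↦ by simp [show ¬ γ ≤ t by linarith [ht.2]])]
    simp

/-- **`∫_b^c N(t) dt = Σ_{j<2000} max(0, c − max(γ_j, b))`** for `0 ≤ b ≤ c ≤ 2516`.
[cite: OdlyzkoTeRiele1985, §4.2 p. 151] -/
theorem integral_zetaZeroCount_eq_sum {b c : ℝ} (h0 : 0 ≤ b) (hbc : b ≤ c) (hc : c ≤ heightT0) :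
    ∫ t in b..c, (zetaZeroCount t : ℝ) =
      ∑ j ∈ Finset.range 2000, max 0 (c - max (lowOrdinate j) b) := by
  have hcongr : ∫ t in b..c, (zetaZeroCount t : ℝ) =
      ∫ t in b..c, ∑ j ∈ Finset.range 2000, if lowOrdinate j ≤ t then (1 : ℝ) else 0 := by
    refine intervalIntegral.integral_congr fun t ht ↦ ?_
    rw [uIcc_of_le hbc] at ht
    exact zetaZeroCount_eq_sum_ite_lowOrdinate (h0.trans ht.1) (ht.2.trans hc)
  have hint : ∀ j ∈ Finset.range 2000,
      IntervalIntegrable (fun t ↦ if lowOrdinate j ≤ t then (1 : ℝ) else 0) volume b c := by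
    intro j _
    refine Monotone.intervalIntegrable fun x y hxy ↦ ?_
    by_cases hx : lowOrdinate j ≤ x
    · simp [hx, hx.trans hxy]
    · by_cases hy : lowOrdinate j ≤ y <;> simp [hx, hy]
  rw [hcongr, intervalIntegral.integral_finsetSum hint]
  exact Finset.sum_congr rfl fun j _ ↦ integral_ite_le_eq_max hbc

/-! ### The three-term Stirling main part of `θ` and its integral -/

/-- **`|θ(t) − θ₃(t)| ≤ 1.2·10⁻⁵` for `t ≥ 2π`**, `θ₃(t) = (t/2)log(t/2π) − t/2 − π/8 + 1/(48t) +
7/(5760t³)` (the third-order bound `0.0754/t⁵ + 0.0762/t⁷ + 50.03/t⁹` at `t ≥ 2π > 6.28`).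
[cite: BrentPlattTrudgian2021, Lemma 2 (proof)] -/
theorem abs_riemannSiegelTheta_sub_main_le_const {t : ℝ} (ht : 2 * π ≤ t) :
    |riemannSiegelTheta t - (t / 2 * Real.log (t / (2 * π)) - t / 2 - π / 8 + 1 / (48 * t)
        + 7 / (5760 * t ^ 3))| ≤ 0.000012 := by
  have hπ : 3.14159 < π := by linarith [Real.pi_gt_d6]
  have ht6 : 6.28318 ≤ t := by linarith
  have h := abs_riemannSiegelTheta_sub_stirling_three_le (by linarith : (2 : ℝ) ≤ t)
  refine h.trans ?_
  have h0 : (0 : ℝ) ≤ 6.28318 := by norm_num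
  have ht5 : (6.28318 : ℝ) ^ 5 ≤ t ^ 5 := pow_le_pow_left₀ h0 ht6 5
  have ht7 : (6.28318 : ℝ) ^ 7 ≤ t ^ 7 := pow_le_pow_left₀ h0 ht6 7
  have ht9 : (6.28318 : ℝ) ^ 9 ≤ t ^ 9 := pow_le_pow_left₀ h0 ht6 9
  have k5 : 0.0754 / t ^ 5 ≤ 0.0754 / (6.28318 : ℝ) ^ 5 :=
    div_le_div_of_nonneg_left (by norm_num) (by positivity) ht5
  have k7 : 0.0762 / t ^ 7 ≤ 0.0762 / (6.28318 : ℝ) ^ 7 :=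
    div_le_div_of_nonneg_left (by norm_num) (by positivity) ht7
  have k9 : 50.03 / t ^ 9 ≤ 50.03 / (6.28318 : ℝ) ^ 9 :=
    div_le_div_of_nonneg_left (by norm_num) (by positivity) ht9
  have : (0.0754 : ℝ) / (6.28318 : ℝ) ^ 5 + 0.0762 / (6.28318 : ℝ) ^ 7 + 50.03 / (6.28318 : ℝ) ^ 9
      ≤ 0.000012 := by norm_num
  linarith

/-- The two small terms of `θ₃`: `0 ≤ 1/(48t) + 7/(5760t³) ≤ 0.00333` for `t ≥ 2π`. [folklore] -/
private theorem main_small_terms_bounds {t : ℝ} (ht : 2 * π ≤ t) :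
    0 ≤ 1 / (48 * t) + 7 / (5760 * t ^ 3) ∧ 1 / (48 * t) + 7 / (5760 * t ^ 3) ≤ 0.00333 := by
  have hπ : 3.14159 < π := by linarith [Real.pi_gt_d6]
  have ht6 : 6.28318 ≤ t := by linarith
  have ht0 : 0 < t := by linarith
  refine ⟨by positivity, ?_⟩
  have ht3 : (6.28318 : ℝ) ^ 3 ≤ t ^ 3 := pow_le_pow_left₀ (by norm_num) ht6 3
  have k1 : 1 / (48 * t) ≤ 1 / (48 * 6.28318) :=
    div_le_div_of_nonneg_left (by norm_num) (by norm_num) (by linarith)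
  have k3 : 7 / (5760 * t ^ 3) ≤ 7 / (5760 * (6.28318 : ℝ) ^ 3) :=
    div_le_div_of_nonneg_left (by norm_num) (by positivity) (by linarith)
  have : (1 : ℝ) / (48 * 6.28318) + 7 / (5760 * (6.28318 : ℝ) ^ 3) ≤ 0.00333 := by norm_num
  linarith

/-- The antiderivative: for `x > 0`,
`d/dx [(x²/4)log(x/2π) − 3x²/8 − πx/8 + (log x)/48 − 7/(11520x²)] = θ₃(x)`. [folklore] -/
private theorem hasDerivAt_thetaMainInt {x : ℝ} (hx : 0 < x) :
    HasDerivAt (fun x ↦ x ^ 2 / 4 * Real.log (x / (2 * π)) - 3 * x ^ 2 / 8 - π * x / 8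
        + Real.log x / 48 - 7 / (11520 * x ^ 2))
      (x / 2 * Real.log (x / (2 * π)) - x / 2 - π / 8 + 1 / (48 * x) + 7 / (5760 * x ^ 3)) x := by
  have hπ := Real.pi_pos
  have hx0 : x ≠ 0 := hx.ne'
  -- `log(y/2π) = log y − log 2π` near `x`, so its derivative is `1/y`
  have hlog : HasDerivAt (fun y ↦ Real.log (y / (2 * π))) (x⁻¹) x := by
    have h : HasDerivAt (fun y ↦ Real.log y - Real.log (2 * π)) (x⁻¹) x :=
      (Real.hasDerivAt_log hx0).sub_const _
    refine h.congr_of_eventuallyEq ?_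
    filter_upwards [lt_mem_nhds hx] with y hy
    rw [Real.log_div hy.ne' (by positivity)]
  have h1 : HasDerivAt (fun y ↦ y ^ 2 / 4 * Real.log (y / (2 * π)))
      ((2 : ℕ) * x ^ (2 - 1) / 4 * Real.log (x / (2 * π)) + x ^ 2 / 4 * x⁻¹) x :=
    ((hasDerivAt_pow 2 x).div_const 4).mul hlog
  have h2 : HasDerivAt (fun y ↦ 3 * y ^ 2 / 8) (3 * ((2 : ℕ) * x ^ (2 - 1)) / 8) x :=
    ((hasDerivAt_pow 2 x).const_mul 3).div_const 8
  have h3 : HasDerivAt (fun y ↦ π * y / 8) (π * 1 / 8) x :=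
    ((hasDerivAt_id x).const_mul π).div_const 8
  have h4 : HasDerivAt (fun y ↦ Real.log y / 48) (x⁻¹ / 48) x :=
    (Real.hasDerivAt_log hx0).div_const 48
  have h5 : HasDerivAt (fun y ↦ 7 / 11520 * (y ^ 2)⁻¹)
      (7 / 11520 * (-((2 : ℕ) * x ^ (2 - 1)) / (x ^ 2) ^ 2)) x :=
    ((hasDerivAt_pow 2 x).inv (pow_ne_zero 2 hx0)).const_mul _
  have h := (((h1.sub h2).sub h3).add h4).sub h5
  have ef : (fun y ↦ y ^ 2 / 4 * Real.log (y / (2 * π)) - 3 * y ^ 2 / 8 - π * y / 8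
        + Real.log y / 48 - 7 / (11520 * y ^ 2)) =
      fun y ↦ y ^ 2 / 4 * Real.log (y / (2 * π)) - 3 * y ^ 2 / 8 - π * y / 8
        + Real.log y / 48 - 7 / 11520 * (y ^ 2)⁻¹ := by
    funext y; ring
  rw [ef]
  refine h.congr_deriv ?_
  push_cast
  field_simp
  ring

/-- **`∫_b^c θ₃ = Θ₃(c) − Θ₃(b)`** for `0 < b ≤ c`. [folklore] -/
private theorem integral_thetaMain_eq {b c : ℝ} (hb : 0 < b) (hbc : b ≤ c) :
    ∫ t in b..c, (t / 2 * Real.log (t / (2 * π)) - t / 2 - π / 8 + 1 / (48 * t) + 7 / (5760 * t ^ 3)) =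
      (c ^ 2 / 4 * Real.log (c / (2 * π)) - 3 * c ^ 2 / 8 - π * c / 8 + Real.log c / 48
          - 7 / (11520 * c ^ 2))
        - (b ^ 2 / 4 * Real.log (b / (2 * π)) - 3 * b ^ 2 / 8 - π * b / 8 + Real.log b / 48
          - 7 / (11520 * b ^ 2)) := by
  refine intervalIntegral.integral_eq_sub_of_hasDerivAt
    (f := fun x ↦ x ^ 2 / 4 * Real.log (x / (2 * π)) - 3 * x ^ 2 / 8 - π * x / 8
        + Real.log x / 48 - 7 / (11520 * x ^ 2)) (fun t ht ↦ ?_) ?_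
  · rw [uIcc_of_le hbc] at ht
    exact hasDerivAt_thetaMainInt (hb.trans_le ht.1)
  · refine ContinuousOn.intervalIntegrable fun t ht ↦ ?_
    rw [uIcc_of_le hbc] at ht
    have ht0 : 0 < t := hb.trans_le ht.1
    have hπ := Real.pi_pos
    refine ContinuousAt.continuousWithinAt ?_
    have h1 : ContinuousAt (fun t : ℝ ↦ Real.log (t / (2 * π))) t :=
      (Real.continuousAt_log (by positivity)).comp (continuousAt_id.div_const _)
    refine ((((continuousAt_id.div_const _).mul h1).sub (continuousAt_id.div_const _)).sub
      continuousAt_const).add ?_ |>.add ?_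
    · exact continuousAt_const.div (continuousAt_const.mul continuousAt_id) (by positivity)
    · exact continuousAt_const.div (continuousAt_const.mul (continuousAt_id.pow 3)) (by positivity)

/-! ### `θ` is `2.75`-Lipschitz on `[2π, 168π]` -/

/-- **`|θ(t) − θ(s)| ≤ 2.75 (t − s)`** for `2π ≤ s ≤ t ≤ 168π`: on this range
`|θ'(u)| ≤ ½ log(u/2π) + 2/u ≤ ½ log 128 + 1/π < 2.75`. [folklore] -/
private theorem abs_riemannSiegelTheta_sub_le_mul_sub {s t : ℝ} (hs : 2 * π ≤ s) (hst : s ≤ t)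
    (ht : t ≤ 168 * π) : |riemannSiegelTheta t - riemannSiegelTheta s| ≤ 2.75 * (t - s) := by
  have hπ3 : 3.14159 < π := by linarith [Real.pi_gt_d6]
  have hbound : ∀ u ∈ Icc (2 * π) (168 * π), ‖riemannSiegelThetaDeriv u‖ ≤ 2.75 := by
    intro u hu
    have hu1 : (1 : ℝ) ≤ u := by linarith [hu.1]
    have hu0 : 0 < u := by linarith
    have hd := abs_le.1 (abs_riemannSiegelThetaDeriv_sub_log_le hu1)
    have hlog0 : 0 ≤ Real.log (u / (2 * π)) :=
      Real.log_nonneg (by rw [le_div_iff₀ (by positivity)]; linarith [hu.1])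
    have hlog : Real.log (u / (2 * π)) ≤ 7 * Real.log 2 := by
      have h128 : Real.log (u / (2 * π)) ≤ Real.log 128 :=
        Real.log_le_log (by positivity) (by rw [div_le_iff₀ (by positivity)]; nlinarith [hu.2])
      have e : Real.log 128 = 7 * Real.log 2 := by
        rw [show (128 : ℝ) = 2 ^ 7 by norm_num, Real.log_pow]; push_cast; ring
      linarith
    have h2 := Real.log_two_lt_d9
    have hinv : 2 / u ≤ 2 / (2 * π) := div_le_div_of_nonneg_left (by norm_num) (by positivity) hu.1
    have hinv' : 2 / (2 * π) < 0.3184 := by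
      rw [div_lt_iff₀ (by positivity)]; nlinarith
    rw [Real.norm_eq_abs, abs_le]
    constructor <;> nlinarith
  have hderiv : ∀ u ∈ Icc (2 * π) (168 * π),
      HasDerivWithinAt riemannSiegelTheta (riemannSiegelThetaDeriv u) (Icc (2 * π) (168 * π)) u :=
    fun u _ ↦ (hasDerivAt_riemannSiegelTheta_holds u).hasDerivWithinAt
  have h := Convex.norm_image_sub_le_of_norm_hasDerivWithin_le hderiv hbound (convex_Icc _ _)
    (show s ∈ Icc (2 * π) (168 * π) from ⟨hs, hst.trans ht⟩)
    (show t ∈ Icc (2 * π) (168 * π) from ⟨hs.trans hst, ht⟩)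
  rw [Real.norm_eq_abs, Real.norm_eq_abs, abs_of_nonneg (sub_nonneg.2 hst)] at h
  exact h

/-! ### `π ∫ S = π ∫ N − ∫ θ − π · length` -/

/-- `π ∫_a^c S = π ∫_a^c N − ∫_a^c θ − π (c − a)` (`S = N − θ/π − 1` by definition).
[cite: Titchmarsh1986, Thm. 9.3] -/
theorem pi_mul_integral_zetaArgS_eq_count_sub_theta (a c : ℝ) :
    π * ∫ t in a..c, zetaArgS t =
      π * (∫ t in a..c, (zetaZeroCount t : ℝ)) - (∫ t in a..c, riemannSiegelTheta t) - π * (c - a) := by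
  have hπ := Real.pi_pos
  have e : zetaArgS = fun t ↦ (zetaZeroCount t : ℝ) - riemannSiegelTheta t / π - 1 := rfl
  rw [e, intervalIntegral.integral_sub, intervalIntegral.integral_sub, intervalIntegral.integral_const,
    intervalIntegral.integral_div, smul_eq_mul, mul_one]
  · field_simp
  · exact intervalIntegrable_zetaZeroCount a c
  · exact (intervalIntegrable_riemannSiegelTheta a c).div_const π
  · exact (intervalIntegrable_zetaZeroCount a c).sub ((intervalIntegrable_riemannSiegelTheta a c).div_const π)
  · exact intervalIntegrable_const

/-! ### The value at a grid point `b ∈ [2π, 168π]` -/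

/-- **`π ∫_b^{168π} S` in closed form up to `0.007`**: for `2π ≤ b ≤ 168π`,
`|π∫_b^{168π} S − (π Σ_{j<2000} max(0, 168π − max(γ_j, b)) − (Θ(168π) − Θ(b)) − π(168π − b))| ≤ 0.007`,
where `Θ(x) = (x²/4)(log x − log 2π) − 3x²/8 − πx/8 + (log x)/48` (the antiderivative of the
three-term main part without its last term `−7/(11520x²) ∈ [−1.6·10⁻⁵, 0]`; the remaining
`|∫_b^{168π}(θ − θ₃)| ≤ 1.2·10⁻⁵ · 168π < 0.0064`).
[cite: BrentPlattTrudgian2021, §2 eq. (2.9) ("a small computation")] -/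
theorem abs_pi_mul_integral_zetaArgS_sub_closedForm_le {b : ℝ} (hb : 2 * π ≤ b) (hbU : b ≤ 168 * π) :
    |π * (∫ t in b..(168 * π), zetaArgS t)
      - (π * (∑ j ∈ Finset.range 2000, max 0 (168 * π - max (lowOrdinate j) b))
        - (((168 * π) ^ 2 / 4 * (Real.log (168 * π) - Real.log (2 * π)) - 3 * (168 * π) ^ 2 / 8
              - π * (168 * π) / 8 + Real.log (168 * π) / 48)
          - (b ^ 2 / 4 * (Real.log b - Real.log (2 * π)) - 3 * b ^ 2 / 8 - π * b / 8
              + Real.log b / 48))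
        - π * (168 * π - b))| ≤ 0.007 := by
  have hπ3 : 3.14159 < π := by linarith [Real.pi_gt_d6]
  have hπ4 : π < 3.1416 := by linarith [Real.pi_lt_d4]
  have hπ := Real.pi_pos
  have hb0 : 0 < b := by linarith
  set U : ℝ := 168 * π with hU
  have hU0 : 0 < U := by positivity
  have hUtop : U ≤ (heightT0 : ℝ) := by
    rw [hU, show (heightT0 : ℝ) = 2516 by norm_num [heightT0]]; nlinarith
  -- the three integrals
  rw [pi_mul_integral_zetaArgS_eq_count_sub_theta, integral_zetaZeroCount_eq_sum hb0.le hbU hUtop]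
  set θ₃ : ℝ → ℝ := fun t ↦ t / 2 * Real.log (t / (2 * π)) - t / 2 - π / 8 + 1 / (48 * t)
    + 7 / (5760 * t ^ 3) with hθ₃
  have hθ₃cont : ContinuousOn θ₃ (Icc b U) := by
    intro t ht
    have ht0 : 0 < t := hb0.trans_le ht.1
    refine ContinuousAt.continuousWithinAt ?_
    have h1 : ContinuousAt (fun t : ℝ ↦ Real.log (t / (2 * π))) t :=
      (Real.continuousAt_log (by positivity)).comp (continuousAt_id.div_const _)
    refine ((((continuousAt_id.div_const _).mul h1).sub (continuousAt_id.div_const _)).sub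
      continuousAt_const).add ?_ |>.add ?_
    · exact continuousAt_const.div (continuousAt_const.mul continuousAt_id) (by positivity)
    · exact continuousAt_const.div (continuousAt_const.mul (continuousAt_id.pow 3)) (by positivity)
  have hθ₃int : IntervalIntegrable θ₃ volume b U := by
    refine ContinuousOn.intervalIntegrable ?_
    rwa [uIcc_of_le hbU]
  have hsplit : ∫ t in b..U, riemannSiegelTheta t =
      (∫ t in b..U, θ₃ t) + ∫ t in b..U, (riemannSiegelTheta t - θ₃ t) := by
    rw [← intervalIntegral.integral_add hθ₃int
      ((intervalIntegrable_riemannSiegelTheta b U).sub hθ₃int)]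
    refine intervalIntegral.integral_congr fun t _ ↦ ?_
    ring
  have hmain : ∫ t in b..U, θ₃ t =
      (U ^ 2 / 4 * Real.log (U / (2 * π)) - 3 * U ^ 2 / 8 - π * U / 8 + Real.log U / 48
          - 7 / (11520 * U ^ 2))
        - (b ^ 2 / 4 * Real.log (b / (2 * π)) - 3 * b ^ 2 / 8 - π * b / 8 + Real.log b / 48
          - 7 / (11520 * b ^ 2)) := integral_thetaMain_eq hb0 hbU
  have herr : |∫ t in b..U, (riemannSiegelTheta t - θ₃ t)| ≤ 0.000012 * |U - b| := by
    have h := intervalIntegral.norm_integral_le_of_norm_le_const (a := b) (b := U) (C := 0.000012)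
      (f := fun t ↦ riemannSiegelTheta t - θ₃ t) (fun t ht ↦ by
        rw [uIoc_of_le hbU] at ht
        rw [Real.norm_eq_abs]
        exact abs_riemannSiegelTheta_sub_main_le_const (by linarith [ht.1]))
    rwa [Real.norm_eq_abs] at h
  rw [abs_of_nonneg (by linarith : 0 ≤ U - b)] at herr
  have hlogU : Real.log (U / (2 * π)) = Real.log U - Real.log (2 * π) :=
    Real.log_div hU0.ne' (by positivity)
  have hlogb : Real.log (b / (2 * π)) = Real.log b - Real.log (2 * π) :=
    Real.log_div hb0.ne' (by positivity)
  rw [hsplit, hmain, hlogU, hlogb]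
  -- the two dropped terms
  have hUb : U - b ≤ 168 * π := by rw [hU]; linarith
  have hsmallU : 0 ≤ 7 / (11520 * U ^ 2) := by positivity
  have hsmallb : 7 / (11520 * b ^ 2) ≤ 0.000016 := by
    have hb2 : 39.47 ≤ b ^ 2 := by nlinarith
    rw [div_le_iff₀ (by positivity)]; nlinarith
  have hsmallUb : 7 / (11520 * U ^ 2) ≤ 7 / (11520 * b ^ 2) := by
    apply div_le_div_of_nonneg_left (by norm_num) (by positivity)
    have : b ^ 2 ≤ U ^ 2 := pow_le_pow_left₀ hb0.le hbU 2
    nlinarith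
  have herr' : |∫ t in b..U, (riemannSiegelTheta t - θ₃ t)| ≤ 0.0064 := by
    refine herr.trans ?_
    nlinarith
  have key : ∀ (E I : ℝ), |I| ≤ 0.0064 → 0 ≤ E → E ≤ 0.000016 →
      |-E - I| ≤ 0.007 := by
    intro E I hI hE0 hE1
    rw [abs_le] at hI ⊢
    constructor <;> linarith [hI.1, hI.2]
  have hfinal := key (7 / (11520 * b ^ 2) - 7 / (11520 * U ^ 2))
    (∫ t in b..U, (riemannSiegelTheta t - θ₃ t)) herr' (by linarith) (by linarith)
  refine le_trans (le_of_eq ?_) hfinal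
  congr 1
  ring

/-! ### One cell `[a, b] ⊆ [2π, 168π]` of width `≤ 1/4` -/

/-- **The cell test implies (2.9) on the cell.** Let `2π ≤ a`, `b ≤ 168π`, `b − a ≤ 1/4`; let
`N⁻ ≤ N(a)`, `N(b) ≤ N⁺`; `θ₀⁻ ≤ θ₀(a) ≤ θ₀⁺` for `θ₀(a) = (a/2)log(a/2π) − a/2 − π/8`;
`J⁻ ≤ π∫_b^{168π} S ≤ J⁺`; `C ≤ π(2.067 + 0.059 log a)`. If
`J⁺ + ¼ max(0, πN⁺ − (θ₀⁻ − 0.687512) − π) ≤ C` and `−J⁻ + ¼ max(0, (θ₀⁺ + 0.690842) + π − πN⁻) ≤ C`,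
then `|∫_{168π}^T S| ≤ 2.067 + 0.059 log T` for every `T ∈ [a, b]`. (On `[a, b]`:
`N⁻ ≤ N ≤ N⁺`; `θ₀(a) − 1.2·10⁻⁵ − 2.75/4 ≤ θ ≤ θ₀(a) + 0.00333 + 1.2·10⁻⁵ + 2.75/4` by the
three-term Stirling bound and the Lipschitz bound; `π∫_T^b S = ∫_T^b (πN − θ − π)`.)
[cite: BrentPlattTrudgian2021, §2 eq. (2.9) ("a small computation")] -/
theorem abs_integral_zetaArgS_le_of_cell {a b : ℝ} (ha : 2 * π ≤ a) (hbU : b ≤ 168 * π)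
    (hh : b - a ≤ 1 / 4) {Nm Np : ℕ} (hNm : Nm ≤ zetaZeroCount a) (hNp : zetaZeroCount b ≤ Np)
    {θlo θhi : ℝ} (hθlo : θlo ≤ a / 2 * Real.log (a / (2 * π)) - a / 2 - π / 8)
    (hθhi : a / 2 * Real.log (a / (2 * π)) - a / 2 - π / 8 ≤ θhi)
    {Jlo Jhi : ℝ} (hJlo : Jlo ≤ π * ∫ t in b..(168 * π), zetaArgS t)
    (hJhi : π * (∫ t in b..(168 * π), zetaArgS t) ≤ Jhi)
    {C : ℝ} (hC : C ≤ π * (2.067 + 0.059 * Real.log a))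
    (hup : Jhi + 1 / 4 * max 0 (π * Np - (θlo - 0.687512) - π) ≤ C)
    (hdn : -Jlo + 1 / 4 * max 0 ((θhi + 0.690842) + π - π * Nm) ≤ C) :
    ∀ T ∈ Icc a b, |∫ t in (168 * π)..T, zetaArgS t| ≤ 2.067 + 0.059 * Real.log T := by
  intro T hT
  have hπ := Real.pi_pos
  have ha0 : 0 < a := by linarith [Real.pi_gt_three]
  set U : ℝ := 168 * π with hU
  -- `θ` on the cell
  have hθa := abs_le.1 (abs_riemannSiegelTheta_sub_main_le_const ha)
  have hsm := main_small_terms_bounds ha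
  have hθcell : ∀ t ∈ Icc a b, θlo - 0.687512 ≤ riemannSiegelTheta t ∧
      riemannSiegelTheta t ≤ θhi + 0.690842 := by
    intro t ht
    have hL := abs_le.1 (abs_riemannSiegelTheta_sub_le_mul_sub ha ht.1 (ht.2.trans hbU))
    have hta : 2.75 * (t - a) ≤ 0.6875 := by linarith [ht.2]
    constructor <;> linarith [hL.1, hL.2, hθa.1, hθa.2, hsm.1, hsm.2]
  -- `N` on the cell
  have hNcell : ∀ t ∈ Icc a b, (Nm : ℝ) ≤ zetaZeroCount t ∧ (zetaZeroCount t : ℝ) ≤ Np := by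
    intro t ht
    have h1 := zetaZeroCount_mono ht.1
    have h2 := zetaZeroCount_mono ht.2
    constructor <;> exact_mod_cast le_trans ‹_› ‹_›
  have hπS : ∀ t, π * zetaArgS t = π * zetaZeroCount t - riemannSiegelTheta t - π := by
    intro t
    show π * ((zetaZeroCount t : ℝ) - riemannSiegelTheta t / π - 1) = _
    field_simp
  -- `π ∫_T^b S` between the constant bounds
  have hintS : IntervalIntegrable (fun t ↦ π * zetaArgS t) volume T b :=
    (intervalIntegrable_zetaArgS T b).const_mul π
  have hTb : T ≤ b := hT.2
  have hup' : π * (∫ t in T..b, zetaArgS t) ≤ (b - T) * (π * Np - (θlo - 0.687512) - π) := by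
    rw [← intervalIntegral.integral_const_mul]
    have h := intervalIntegral.integral_mono_on hTb hintS intervalIntegrable_const
      (g := fun _ ↦ π * Np - (θlo - 0.687512) - π) (fun t ht ↦ by
        have ht' : t ∈ Icc a b := ⟨hT.1.trans ht.1, ht.2⟩
        have hN := mul_le_mul_of_nonneg_left (hNcell t ht').2 hπ.le
        rw [hπS]
        linarith [(hθcell t ht').1])
    rwa [intervalIntegral.integral_const, smul_eq_mul] at h
  have hdn' : (b - T) * (π * Nm - (θhi + 0.690842) - π) ≤ π * (∫ t in T..b, zetaArgS t) := by
    rw [← intervalIntegral.integral_const_mul]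
    have h := intervalIntegral.integral_mono_on hTb intervalIntegrable_const hintS
      (f := fun _ ↦ π * Nm - (θhi + 0.690842) - π) (fun t ht ↦ by
        have ht' : t ∈ Icc a b := ⟨hT.1.trans ht.1, ht.2⟩
        have hN := mul_le_mul_of_nonneg_left (hNcell t ht').1 hπ.le
        rw [hπS]
        linarith [(hθcell t ht').2])
    rwa [intervalIntegral.integral_const, smul_eq_mul] at h
  -- with `0 ≤ b − T ≤ 1/4`
  have hbT0 : 0 ≤ b - T := by linarith
  have hbT : b - T ≤ 1 / 4 := by linarith [hT.1]
  have hup'' : π * (∫ t in T..b, zetaArgS t) ≤ 1 / 4 * max 0 (π * Np - (θlo - 0.687512) - π) := by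
    have hm := le_max_right 0 (π * Np - (θlo - 0.687512) - π)
    have hm0 := le_max_left 0 (π * Np - (θlo - 0.687512) - π)
    have h1 := mul_le_mul_of_nonneg_left hm hbT0
    have h2 := mul_le_mul_of_nonneg_right hbT hm0
    linarith
  have hdn'' : -(1 / 4 * max 0 ((θhi + 0.690842) + π - π * Nm)) ≤ π * (∫ t in T..b, zetaArgS t) := by
    have hm := le_max_right 0 ((θhi + 0.690842) + π - π * Nm)
    have hm0 := le_max_left 0 ((θhi + 0.690842) + π - π * Nm)
    have h1 := mul_le_mul_of_nonneg_left hm hbT0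
    have h2 := mul_le_mul_of_nonneg_right hbT hm0
    linarith
  -- `∫_T^U = ∫_T^b + ∫_b^U`, and the comparison constant
  have hsplit : ∫ t in T..U, zetaArgS t = (∫ t in T..b, zetaArgS t) + ∫ t in b..U, zetaArgS t :=
    (intervalIntegral.integral_add_adjacent_intervals (intervalIntegrable_zetaArgS _ _)
      (intervalIntegrable_zetaArgS _ _)).symm
  have hlogT : Real.log a ≤ Real.log T := Real.log_le_log ha0 hT.1
  have hCT : C ≤ π * (2.067 + 0.059 * Real.log T) := by
    have := mul_le_mul_of_nonneg_left hlogT hπ.le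
    linarith
  have hI_up : π * (∫ t in T..U, zetaArgS t) ≤ π * (2.067 + 0.059 * Real.log T) := by
    rw [hsplit, mul_add]; linarith
  have hI_dn : π * (-(2.067 + 0.059 * Real.log T)) ≤ π * (∫ t in T..U, zetaArgS t) := by
    rw [hsplit, mul_add, mul_neg]; linarith
  rw [intervalIntegral.integral_symm, abs_neg, abs_le]
  exact ⟨le_of_mul_le_mul_left hI_dn hπ, le_of_mul_le_mul_left hI_up hπ⟩

/-! ### The closed form for `π∫_b^{168π} S` with a sharp error (gen 8, for `S₁(168π)`) -/

/-- `∫_b^c (0.0754/t⁵ + 0.0762/t⁷ + 50.03/t⁹) dt ≤ 0.0754/(4b⁴) + 0.0762/(6b⁶) + 50.03/(8b⁸)` for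
`0 < b ≤ c`. [folklore] -/
private theorem integral_stirlingRemainder_le {b c : ℝ} (hb : 0 < b) (hbc : b ≤ c) :
    ∫ t in b..c, (0.0754 / t ^ 5 + 0.0762 / t ^ 7 + 50.03 / t ^ 9) ≤
      0.0754 / (4 * b ^ 4) + 0.0762 / (6 * b ^ 6) + 50.03 / (8 * b ^ 8) := by
  -- antiderivative `P(t) = −0.0754/(4t⁴) − 0.0762/(6t⁶) − 50.03/(8t⁸)`
  have hP : ∀ t : ℝ, 0 < t → HasDerivAt (fun t : ℝ ↦ -(0.0754 / (4 * t ^ 4)) - 0.0762 / (6 * t ^ 6)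
      - 50.03 / (8 * t ^ 8)) (0.0754 / t ^ 5 + 0.0762 / t ^ 7 + 50.03 / t ^ 9) t := by
    intro t ht
    have ht0 : t ≠ 0 := ht.ne'
    have hk : ∀ (n : ℕ) (k a : ℝ), k ≠ 0 → HasDerivAt (fun t : ℝ ↦ a / (k * t ^ (n + 1)))
        (-(a * (n + 1)) / (k * t ^ (n + 2))) t := by
      intro n k a hk
      have hpow := (hasDerivAt_pow (n + 1) t)
      have hinv := hpow.fun_inv (pow_ne_zero (n + 1) ht0)
      have h := hinv.const_mul (a / k)
      have ef : (fun t : ℝ ↦ a / (k * t ^ (n + 1))) = fun t ↦ a / k * (t ^ (n + 1))⁻¹ := by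
        funext t; rw [div_mul_eq_div_div, div_eq_mul_inv]
      rw [ef]
      refine h.congr_deriv ?_
      simp only [Nat.add_sub_cancel]
      push_cast
      field_simp
      ring
    have h4 := hk 3 4 0.0754 (by norm_num)
    have h6 := hk 5 6 0.0762 (by norm_num)
    have h8 := hk 7 8 50.03 (by norm_num)
    have h := (h4.neg.sub h6).sub h8
    refine (show HasDerivAt (fun t : ℝ ↦ -(0.0754 / (4 * t ^ 4)) - 0.0762 / (6 * t ^ 6)
      - 50.03 / (8 * t ^ 8)) _ t from h).congr_deriv ?_
    push_cast
    field_simp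
    ring
  have hcont : ContinuousOn (fun t : ℝ ↦ 0.0754 / t ^ 5 + 0.0762 / t ^ 7 + 50.03 / t ^ 9) (uIcc b c) := by
    intro t ht
    rw [uIcc_of_le hbc] at ht
    have ht0 : t ≠ 0 := (hb.trans_le ht.1).ne'
    have : ∀ n : ℕ, ContinuousAt (fun t : ℝ ↦ t ^ n) t := fun n ↦ (continuous_pow n).continuousAt
    refine ContinuousAt.continuousWithinAt ?_
    refine ((continuousAt_const.div (this 5) (pow_ne_zero 5 ht0)).add
      (continuousAt_const.div (this 7) (pow_ne_zero 7 ht0))).add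
      (continuousAt_const.div (this 9) (pow_ne_zero 9 ht0))
  rw [intervalIntegral.integral_eq_sub_of_hasDerivAt (fun t ht ↦ hP t (by
      rw [uIcc_of_le hbc] at ht; exact hb.trans_le ht.1)) (hcont.intervalIntegrable (μ := volume))]
  have hc0 : 0 < c := hb.trans_le hbc
  have : 0 ≤ 0.0754 / (4 * c ^ 4) + 0.0762 / (6 * c ^ 6) + 50.03 / (8 * c ^ 8) := by positivity
  linarith

/-- **`π ∫_b^{168π} S` in closed form up to `1.6·10⁻⁵`** (sharp version of
`abs_pi_mul_integral_zetaArgS_sub_closedForm_le`, with the term `−7/(11520x²)` of the antiderivative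
kept): for `2π ≤ b ≤ 168π`,
`|π∫_b^{168π} S − (π Σ_{j<2000} max(0, 168π − max(γ_j, b)) − (Θ₃(168π) − Θ₃(b)) − π(168π − b))| ≤ 1.6·10⁻⁵`,
`Θ₃(x) = (x²/4)(log x − log 2π) − 3x²/8 − πx/8 + (log x)/48 − 7/(11520x²)`; the error is
`|∫_b^{168π}(θ − θ₃)| ≤ ∫_b^∞ (0.0754/t⁵ + 0.0762/t⁷ + 50.03/t⁹) dt ≤ 1.5·10⁻⁵` at `b ≥ 2π`.
[cite: BrentPlattTrudgian2021, §2 eq. (2.9) ("a small computation")] -/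
theorem abs_pi_mul_integral_zetaArgS_sub_closedForm_le_sharp {b : ℝ} (hb : 2 * π ≤ b)
    (hbU : b ≤ 168 * π) :
    |π * (∫ t in b..(168 * π), zetaArgS t)
      - (π * (∑ j ∈ Finset.range 2000, max 0 (168 * π - max (lowOrdinate j) b))
        - (((168 * π) ^ 2 / 4 * (Real.log (168 * π) - Real.log (2 * π)) - 3 * (168 * π) ^ 2 / 8
              - π * (168 * π) / 8 + Real.log (168 * π) / 48 - 7 / (11520 * (168 * π) ^ 2))
          - (b ^ 2 / 4 * (Real.log b - Real.log (2 * π)) - 3 * b ^ 2 / 8 - π * b / 8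
              + Real.log b / 48 - 7 / (11520 * b ^ 2)))
        - π * (168 * π - b))| ≤ 0.000016 := by
  have hπ3 : 3.14159 < π := by linarith [Real.pi_gt_d6]
  have hπ := Real.pi_pos
  have hb0 : 0 < b := by linarith
  set U : ℝ := 168 * π with hU
  have hU0 : 0 < U := by positivity
  have hUtop : U ≤ (heightT0 : ℝ) := by
    rw [hU, show (heightT0 : ℝ) = 2516 by norm_num [heightT0]]; nlinarith [Real.pi_lt_d4]
  rw [pi_mul_integral_zetaArgS_eq_count_sub_theta, integral_zetaZeroCount_eq_sum hb0.le hbU hUtop]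
  set θ₃ : ℝ → ℝ := fun t ↦ t / 2 * Real.log (t / (2 * π)) - t / 2 - π / 8 + 1 / (48 * t)
    + 7 / (5760 * t ^ 3) with hθ₃
  have hθ₃cont : ContinuousOn θ₃ (Icc b U) := by
    intro t ht
    have ht0 : 0 < t := hb0.trans_le ht.1
    refine ContinuousAt.continuousWithinAt ?_
    have h1 : ContinuousAt (fun t : ℝ ↦ Real.log (t / (2 * π))) t :=
      (Real.continuousAt_log (by positivity)).comp (continuousAt_id.div_const _)
    refine ((((continuousAt_id.div_const _).mul h1).sub (continuousAt_id.div_const _)).sub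
      continuousAt_const).add ?_ |>.add ?_
    · exact continuousAt_const.div (continuousAt_const.mul continuousAt_id) (by positivity)
    · exact continuousAt_const.div (continuousAt_const.mul (continuousAt_id.pow 3)) (by positivity)
  have hθ₃int : IntervalIntegrable θ₃ volume b U := by
    refine ContinuousOn.intervalIntegrable ?_
    rwa [uIcc_of_le hbU]
  have hi2 : IntervalIntegrable (fun t ↦ riemannSiegelTheta t - θ₃ t) volume b U :=
    (intervalIntegrable_riemannSiegelTheta b U).sub hθ₃int
  have hsplit : ∫ t in b..U, riemannSiegelTheta t =
      (∫ t in b..U, θ₃ t) + ∫ t in b..U, (riemannSiegelTheta t - θ₃ t) := by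
    rw [← intervalIntegral.integral_add hθ₃int hi2]
    refine intervalIntegral.integral_congr fun t _ ↦ ?_
    ring
  have hmain : ∫ t in b..U, θ₃ t =
      (U ^ 2 / 4 * Real.log (U / (2 * π)) - 3 * U ^ 2 / 8 - π * U / 8 + Real.log U / 48
          - 7 / (11520 * U ^ 2))
        - (b ^ 2 / 4 * Real.log (b / (2 * π)) - 3 * b ^ 2 / 8 - π * b / 8 + Real.log b / 48
          - 7 / (11520 * b ^ 2)) := integral_thetaMain_eq hb0 hbU
  -- the sharp remainder
  have herr : |∫ t in b..U, (riemannSiegelTheta t - θ₃ t)| ≤ 0.000016 := by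
    have h := intervalIntegral.norm_integral_le_of_norm_le hbU (μ := volume)
      (f := fun t ↦ riemannSiegelTheta t - θ₃ t)
      (g := fun t ↦ 0.0754 / t ^ 5 + 0.0762 / t ^ 7 + 50.03 / t ^ 9)
      (Filter.Eventually.of_forall fun t ht ↦ by
        rw [Real.norm_eq_abs]
        exact abs_riemannSiegelTheta_sub_stirling_three_le (by linarith [ht.1]))
      (by
        refine ContinuousOn.intervalIntegrable (μ := volume) fun t ht ↦ ?_
        rw [uIcc_of_le hbU] at ht
        have ht0 : t ≠ 0 := (hb0.trans_le ht.1).ne'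
        have : ∀ n : ℕ, ContinuousAt (fun t : ℝ ↦ t ^ n) t := fun n ↦ (continuous_pow n).continuousAt
        refine ContinuousAt.continuousWithinAt ?_
        exact ((continuousAt_const.div (this 5) (pow_ne_zero 5 ht0)).add
          (continuousAt_const.div (this 7) (pow_ne_zero 7 ht0))).add
          (continuousAt_const.div (this 9) (pow_ne_zero 9 ht0)))
    rw [Real.norm_eq_abs] at h
    refine h.trans ((integral_stirlingRemainder_le hb0 hbU).trans ?_)
    have hb4 : (6.28318 : ℝ) ^ 4 ≤ b ^ 4 := pow_le_pow_left₀ (by norm_num) (by linarith) 4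
    have hb6 : (6.28318 : ℝ) ^ 6 ≤ b ^ 6 := pow_le_pow_left₀ (by norm_num) (by linarith) 6
    have hb8 : (6.28318 : ℝ) ^ 8 ≤ b ^ 8 := pow_le_pow_left₀ (by norm_num) (by linarith) 8
    have k4 : 0.0754 / (4 * b ^ 4) ≤ 0.0754 / (4 * (6.28318 : ℝ) ^ 4) :=
      div_le_div_of_nonneg_left (by norm_num) (by positivity) (by linarith)
    have k6 : 0.0762 / (6 * b ^ 6) ≤ 0.0762 / (6 * (6.28318 : ℝ) ^ 6) :=
      div_le_div_of_nonneg_left (by norm_num) (by positivity) (by linarith)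
    have k8 : 50.03 / (8 * b ^ 8) ≤ 50.03 / (8 * (6.28318 : ℝ) ^ 8) :=
      div_le_div_of_nonneg_left (by norm_num) (by positivity) (by linarith)
    have : 0.0754 / (4 * (6.28318 : ℝ) ^ 4) + 0.0762 / (6 * (6.28318 : ℝ) ^ 6)
        + 50.03 / (8 * (6.28318 : ℝ) ^ 8) ≤ 0.000016 := by norm_num
    linarith
  have hlogU : Real.log (U / (2 * π)) = Real.log U - Real.log (2 * π) :=
    Real.log_div hU0.ne' (by positivity)
  have hlogb : Real.log (b / (2 * π)) = Real.log b - Real.log (2 * π) :=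
    Real.log_div hb0.ne' (by positivity)
  rw [hsplit, hmain, hlogU, hlogb]
  rw [← abs_neg] at herr
  convert herr using 2
  ring

end Literature.NumberTheory.LFunctions
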